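import Summits.CriticalPhenomena.SAWScalingLimit.Theses.SAWRenewalTightness
import Summits.CriticalPhenomena.SAWScalingLimit.Theorems.SAWRenewalTightnessShellCrossingBoundSocketTransfer
import Literature.Probability.RandomPlanarGeometry.SAWRestrictionCovariance
import Literature.Probability.RandomPlanarGeometry.SelfAvoidingWalkProofs
import Literature.Probability.LatticeModels.DiluteLoopModelSAWLaw
import HarnessLib

/-!
# `ShellCrossingBound`, line `pinch-on-a-circle`, stub E `stub_confinementPositivity`: audit

Crux item `stmt-CriticalPhenomena-4728` (`SAWRenewalTightness.ShellCrossingBound`), registered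
stub `stub_confinementPositivity` (STUB E, "confinement positivity", `ConfinementPositivity` of
the line skeleton): for Dobrushin domains `D' ⊆ D` with the same marked points, coinciding
inside the socket balls `B(a, d) ∪ B(b, d)`, the critical SAW of the BIG domain `D` from `a_δ`
to `b_δ` is (the support of) a walk of the small discrete domain `D'_δ` with probability
`≥ c > 0`, uniformly in `δ ≤ δ₀`.

This work file does NOT prove the stub (an RSW-type lower bound on a constrained critical SAW
partition function; none is known on `ℤ²`).  It certifies, kernel-checked, WHAT EXACTLY is
missing: the registered statement is EQUIVALENT (`confinementPositivity_iff_partitionRatio`) to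
the partition-function ratio bound

  `∀ (admissible D, D', a, b, d), ∃ c δ₀ > 0, ∀ δ ∈ (0, δ₀],
      ofReal c * weight D.carrier δ (a δ) (b δ) univ ≤ weight D'.carrier δ (a δ) (b δ) univ`,

i.e. `liminf_{δ → 0} Z_{D'}(a_δ, b_δ) / Z_D(a_δ, b_δ) > 0` for the critical partition functions
`Z = ∑_γ x_c^{|γ|}`.  Ingredients: nesting of the discrete domains for small meshes
(`JordanDomain.exists_forall_meshDomain_subset`, `exists_domainSAW_of_meshDomain_subset`), the
exact restriction identity `law_D(Conf D') = Z_D⁻¹ Z_{D'}` under nesting (Literature,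
`SAWRestrictionCovariance.lean`: `SAW.le_law_setOf_exists_support_eq_iff`), `0 < Z_D < ∞` for
small `δ` (reachability of the endpoint approximation, `x_c > 0`, finiteness of the discrete domain).
-/

noncomputable section

namespace Summit.CriticalPhenomena.SAWScalingLimit.Theorems

open MeasureTheory Set Metric Filter Topology
open scoped ENNReal
open Literature.Probability.RandomPlanarGeometry Literature.Probability.LatticeModels

/-! ### `0 < Z < ∞` -/

section Partition

variable {Ω : Set ℂ} {δ : ℝ} {u v : Site 2}

/-- A vertex joined in `Ω_δ` to a different vertex lies in the discrete domain. [folklore] -/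
theorem ConfinementAudit.mem_meshDomain_of_reachable
    (h : (discreteDomainGraph Ω δ).Reachable u v) (huv : u ≠ v) : u ∈ meshDomain Ω δ := by
  obtain ⟨p⟩ := h
  cases p with
  | nil => exact absurd rfl huv
  | cons hadj _ => exact (discreteDomainGraph_adj_iff.1 hadj).2.1

/-- `Z > 0` as soon as the endpoints are joined in `Ω_δ` (the bypass of a joining walk is a SAW
of positive weight `x_c^{n} > 0`). [folklore] -/
theorem ConfinementAudit.weight_univ_ne_zero (h : (discreteDomainGraph Ω δ).Reachable u v) :
    SAW.weight Ω δ u v Set.univ ≠ 0 := by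
  obtain ⟨p⟩ := h
  set γ : SAW.DomainSAW Ω δ u v := ⟨p.bypass, p.bypass_isPath⟩
  have hγ : SAW.weight Ω δ u v {γ} ≤ SAW.weight Ω δ u v Set.univ :=
    measure_mono (Set.subset_univ _)
  rw [SAW.weight_singleton] at hγ
  have hpos : 0 < ENNReal.ofReal (SAW.criticalFugacity ^ γ.length) :=
    ENNReal.ofReal_pos.2 (pow_pos SAW.criticalFugacity_pos_lt_one'.1 _)
  exact (hpos.trans_le hγ).ne'

/-- `Z < ∞` for a bounded domain and a positive mesh (finitely many SAWs). [folklore] -/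
theorem ConfinementAudit.weight_univ_ne_top (hΩ : Bornology.IsBounded Ω) (hδ : 0 < δ) :
    SAW.weight Ω δ u v Set.univ ≠ ⊤ := by
  classical
  by_cases huv : u = v
  · subst huv
    have hall : (Set.univ : Set (SAW.DomainSAW Ω δ u u)) = {SAW.DomainSAW.nil u} := by
      refine Set.eq_singleton_iff_unique_mem.2 ⟨Set.mem_univ _, fun γ _ => ?_⟩
      obtain ⟨p, hp⟩ := γ
      have hp' : p = SimpleGraph.Walk.nil :=
        SimpleGraph.Walk.eq_nil_iff_nil.2 (SimpleGraph.Walk.isPath_iff_nil.1 hp)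
      subst hp'
      rfl
    rw [hall, SAW.weight_singleton]
    exact ENNReal.ofReal_ne_top
  by_cases hu : u ∈ meshDomain Ω δ
  · have hu' : u ∈ meshDomainFinset Ω δ := by
      rw [← Finset.mem_coe, coe_meshDomainFinset hΩ hδ]
      exact hu
    rw [DiluteLoopModel.SAW.weight_univ_eq_domainPartitionFunction hu' huv]
    exact ENNReal.ofReal_ne_top
  · have hall : (Set.univ : Set (SAW.DomainSAW Ω δ u v)) = ∅ := by
      refine Set.eq_empty_iff_forall_notMem.2 fun γ _ => hu ?_
      exact ConfinementAudit.mem_meshDomain_of_reachable γ.walk.reachable huv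
    rw [hall, measure_empty]
    exact ENNReal.zero_ne_top

end Partition

/-! ### The registered statement is equivalent to the partition-function ratio bound -/

/-- **Audit of STUB E.** The registered statement `stub_confinementPositivity`
(= `ConfinementPositivity` of the line skeleton) is EQUIVALENT to the lower bound on the ratio
of critical partition functions `Z_{D'}(a_δ, b_δ) ≥ c · Z_D(a_δ, b_δ)` for `δ ≤ δ₀` over the same
admissible data.  (`→`: `c ≤ law_D(Conf) = Z_D⁻¹ W_D(Conf) ≤ Z_D⁻¹ Z_{D'}` by
`SAW.weight_setOf_exists_support_eq_le`, no nesting needed, and `Z_D < ∞` is forced by `c > 0`;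
`←`: for `δ` below the nesting threshold of `JordanDomain.exists_forall_meshDomain_subset` and the
reachability threshold of the endpoint approximation, `law_D(Conf) = Z_D⁻¹ Z_{D'}` with
`0 < Z_D < ∞`.)  The right-hand side — `liminf_{δ→0} Z_{D'}/Z_D > 0`, an RSW-type lower bound
for the critical `ℤ²` SAW — is the open content; no named fact of the tree supplies it.
[folklore] -/
theorem confinementPositivity_iff_partitionRatio :
    (∀ (D D' : DobrushinDomain) (a b : ℝ → Site 2) (d : ℝ), 0 < d →
      D'.carrier ⊆ D.carrier → D'.pt 0 = D.pt 0 → D'.pt 1 = D.pt 1 →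
      D.carrier ∩ (Metric.ball (D.pt 0) d ∪ Metric.ball (D.pt 1) d) ⊆ D'.carrier →
      SAW.IsEndpointApprox D' a b →
        ∃ c δ₀ : ℝ, 0 < c ∧ 0 < δ₀ ∧ ∀ δ ∈ Set.Ioc (0 : ℝ) δ₀,
          ENNReal.ofReal c ≤ SAW.law D.carrier δ (a δ) (b δ)
            {γ | ∃ γ' : SAW.DomainSAW D'.carrier δ (a δ) (b δ),
              γ'.walk.support = γ.walk.support}) ↔
    (∀ (D D' : DobrushinDomain) (a b : ℝ → Site 2) (d : ℝ), 0 < d →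
      D'.carrier ⊆ D.carrier → D'.pt 0 = D.pt 0 → D'.pt 1 = D.pt 1 →
      D.carrier ∩ (Metric.ball (D.pt 0) d ∪ Metric.ball (D.pt 1) d) ⊆ D'.carrier →
      SAW.IsEndpointApprox D' a b →
        ∃ c δ₀ : ℝ, 0 < c ∧ 0 < δ₀ ∧ ∀ δ ∈ Set.Ioc (0 : ℝ) δ₀,
          ENNReal.ofReal c * SAW.weight D.carrier δ (a δ) (b δ) Set.univ ≤
            SAW.weight D'.carrier δ (a δ) (b δ) Set.univ) := by
  constructor
  · intro hE D D' a b d hd hsub h0 h1 hsock hab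
    obtain ⟨c, δ₀, hc, hδ₀, hconf⟩ := hE D D' a b d hd hsub h0 h1 hsock hab
    refine ⟨c, δ₀, hc, hδ₀, fun δ hδ => ?_⟩
    have h := hconf δ hδ
    rw [SAW.law_apply_eq_inv_mul_weight] at h
    set Z := SAW.weight D.carrier δ (a δ) (b δ) Set.univ with hZ
    set Z' := SAW.weight D'.carrier δ (a δ) (b δ) Set.univ with hZ'
    have h' : ENNReal.ofReal c ≤ Z⁻¹ * Z' :=
      h.trans (mul_le_mul' le_rfl (SAW.weight_setOf_exists_support_eq_le _ _ δ (a δ) (b δ)))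
    have hc' : (0 : ℝ≥0∞) < ENNReal.ofReal c := ENNReal.ofReal_pos.2 hc
    have hZtop : Z ≠ ⊤ := by
      intro htop
      rw [htop, ENNReal.inv_top, zero_mul] at h'
      exact hc'.ne' (le_antisymm h' bot_le)
    by_cases hZ0 : Z = 0
    · rw [hZ0, mul_zero]; exact bot_le
    calc ENNReal.ofReal c * Z ≤ Z⁻¹ * Z' * Z := mul_le_mul' h' le_rfl
      _ = Z' := by rw [mul_comm, ← mul_assoc, ENNReal.mul_inv_cancel hZ0 hZtop, one_mul]
  · intro hR D D' a b d hd hsub h0 h1 hsock hab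
    obtain ⟨c, δ₀, hc, hδ₀, hratio⟩ := hR D D' a b d hd hsub h0 h1 hsock hab
    -- nesting of the discrete domains for `δ ≤ δN`
    obtain ⟨δN, hδN, hnest⟩ :=
      D'.toJordanDomain.exists_forall_meshDomain_subset D.toJordanDomain hsub
    -- reachability of the endpoints in `D'_δ` for `δ < δR`
    obtain ⟨δR, hδR, hreach⟩ := (nhdsGT_basis (0 : ℝ)).eventually_iff.1 hab.reachable
    refine ⟨c, min δ₀ (min δN (δR / 2)), hc, lt_min hδ₀ (lt_min hδN (half_pos hδR)),
      fun δ hδ => ?_⟩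
    have hδ0 : δ ∈ Set.Ioc (0 : ℝ) δ₀ := ⟨hδ.1, hδ.2.trans (min_le_left _ _)⟩
    have hδN' : δ ≤ δN := hδ.2.trans ((min_le_right _ _).trans (min_le_left _ _))
    have hδR' : δ ∈ Set.Ioo (0 : ℝ) δR :=
      ⟨hδ.1, by have := hδ.2.trans ((min_le_right _ _).trans (min_le_right _ _)); linarith⟩
    have hN : ∀ γ' : SAW.DomainSAW D'.carrier δ (a δ) (b δ),
        ∃ γ : SAW.DomainSAW D.carrier δ (a δ) (b δ), γ.walk.support = γ'.walk.support :=
      fun γ' => exists_domainSAW_of_meshDomain_subset hsub (hnest δ hδ.1 hδN') γ'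
    -- `0 < Z_D < ∞`
    have hrD : (discreteDomainGraph D.carrier δ).Reachable (a δ) (b δ) := by
      obtain ⟨p⟩ := hreach hδR'
      obtain ⟨γ, -⟩ := hN ⟨p.bypass, p.bypass_isPath⟩
      exact γ.walk.reachable
    have hZ0 : SAW.weight D.carrier δ (a δ) (b δ) Set.univ ≠ 0 :=
      ConfinementAudit.weight_univ_ne_zero hrD
    have hZtop : SAW.weight D.carrier δ (a δ) (b δ) Set.univ ≠ ⊤ :=
      ConfinementAudit.weight_univ_ne_top D.isBounded hδ.1
    exact (SAW.le_law_setOf_exists_support_eq_iff hN hZ0 hZtop _).2 (hratio δ hδ0)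

end Summit.CriticalPhenomena.SAWScalingLimit.Theorems

end
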